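import Literature.Computability.MetaComplexity.McKayMurrayWilliams2019.UniformStreamingProofs
import HarnessLib

/-!
# McKay–Murray–Williams 2019, Thm. 1.3 — the trivial range of the streaming hypothesis

D. M. McKay, C. D. Murray, R. R. Williams, *Weak lower bounds on resource-bounded compression
imply strong separations of complexity classes*, STOC 2019, doi:10.1145/3313276.3316396,
Theorem 1.3 (§1.1): a `poly(s(n))`-space, `poly(s(n))`-update-time streaming lower bound for
`MCSP[s(n)]`, for ONE time-constructible `s(n) ≥ n`, implies `P ≠ NP`.  The tree renders the
hypothesis as `StreamingLowerBound s` (`UniformStreaming.lean`) and the theorem is proved for every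
time-constructible `s` (`UniformStreamingConstructible.lean`, `thm13_holds`).

What is proved here (folklore; Arora–Barak 2009, Claim 2.13 "every function has a circuit of size
`O(2ⁿ)`", in the tree's form `cktSize_univ_fin` / `univBound n = 5·2ⁿ - 4`): the hypothesis is
EMPTY at the top of the range.  If `s n ≥ univBound n` for all `n`, then `MCSP[s]` is just the set
of strings of power-of-two length, which ONE uniform streaming algorithm with EMPTY state decides
(the report machine checks `N = 2^{⌊log₂ N⌋}` from `bin N` in `poly(log N)` steps), so
`MCSP[s] ∈ USTREAM[s(log₂ N)^c + c]` unconditionally and `StreamingLowerBound s` fails: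

* `univBound_le_two_pow_three_mul` — `univBound n ≤ 2^{3n}`;
* `mem_MCSPSize_iff_of_univBound_le` — for such `s`, `w ∈ MCSP[s] ↔ |w| = 2^{⌊log₂|w|⌋}`;
* `MCSPSize_mem_USTREAM_of_univBound_le` — for such `s`, `∃ c, MCSP[s] ∈ USTREAM[s(log₂N)^c + c]`
  (no hypothesis on `P` vs `NP`, no constructibility of `s`);
* `not_streamingLowerBound_of_univBound_le`, `not_streamingLowerBound_two_pow_mul` (`k ≥ 3`) —
  in particular the instances `thm13_two_pow_mul k` of `UniformStreamingConstructible.lean` with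
  `k ≥ 3` have an unsatisfiable hypothesis: the informative range of Theorem 1.3 is
  `n ≤ s(n) < univBound n` (in the paper's words, compression to circuits of size `N^{o(1)}` or
  `n^c`, §1 / §1.1), not `s(n) = 2^{kn}`.

No notion, definition or named fact is introduced (theorems only).

## References

* D. M. McKay, C. D. Murray, R. R. Williams, STOC 2019, Thm. 1.3 and the discussion following it
  (§1.1) [McKayMurrayWilliams2019].
* S. Arora, B. Barak, *Computational Complexity: A Modern Approach*, CUP 2009, Claim 2.13
  (every Boolean function on `n` bits has a circuit of size `O(2ⁿ)`; here `cktSize_univ_fin`)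
  [AroraBarakCC2009].
-/

namespace Literature.Computability.MetaComplexity.McKayMurrayWilliams2019

open _root_.Computability
open Literature.Computability.Complexity Literature.Computability.MetaComplexity CodeFP Polynomial
open StreamingAlgorithm

/-- `univBound n = 5·2ⁿ - 4 ≤ 8ⁿ`. [folklore] -/
theorem univBound_le_two_pow_three_mul (n : ℕ) : univBound n ≤ 2 ^ (3 * n) := by
  induction n with
  | zero => simp [univBound]
  | succ n ih =>
    have h8 : 2 ^ (3 * (n + 1)) = 2 ^ (3 * n) * 8 := by
      rw [show 3 * (n + 1) = 3 * n + 3 by ring, pow_add]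
      norm_num
    have h1 : 1 ≤ 2 ^ (3 * n) := Nat.one_le_two_pow
    show 2 * univBound n + 4 ≤ 2 ^ (3 * (n + 1))
    rw [h8]
    omega

/-- **Above the universal bound, `MCSP[s]` is the set of strings of power-of-two length**
(Arora–Barak 2009, Claim 2.13: every `n`-ary function has a `B₂`-circuit of size `≤ univBound n`).
[cite: AroraBarakCC2009, Claim 2.13] -/
theorem mem_MCSPSize_iff_of_univBound_le {s : ℕ → ℕ} (hs : ∀ n, univBound n ≤ s n)
    (w : List Bool) : w ∈ MCSPSize s ↔ w.length = 2 ^ Nat.log 2 w.length := by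
  constructor
  · rintro ⟨n, f, rfl, -⟩
    rw [length_truthTable, Nat.log_pow Nat.one_lt_two]
  · intro h
    have hw : w = truthTable (ofTruthTable w h) := (truthTable_ofTruthTable w h).symm
    rw [hw, truthTable_mem_MCSPSize_iff]
    obtain ⟨K, hB, hsz, he⟩ :=
      (cktSize_univ_fin _ fun v (_ : Unit) => ofTruthTable w h v).toCircuit
    exact ((circuitSizeOver_le_of_computes K hB he).trans hsz).trans (hs _)

/-- **Above the universal bound, `MCSP[s]` is uniformly streamable with empty state**: for every
`s` with `univBound n ≤ s n` there is `c` with `MCSP[s] ∈ USTREAM[s(⌊log₂N⌋)^c + c]` (space and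
update / report time) — unconditionally, by the algorithm that keeps no state and reports
`[N = 2^{⌊log₂ N⌋}]`. [folklore] -/
theorem MCSPSize_mem_USTREAM_of_univBound_le {s : ℕ → ℕ} (hs : ∀ n, univBound n ≤ s n) :
    ∃ c : ℕ, MCSPSize s ∈
      USTREAM (fun N => s (Nat.log 2 N) ^ c + c) (fun N => s (Nat.log 2 N) ^ c + c) := by
  have hun : ∀ n, n ≤ univBound n := fun n => by
    induction n with
    | zero => simp [univBound]
    | succ n ih =>
      show n + 1 ≤ 2 * univBound n + 4
      omega
  have hsn : ∀ n, n ≤ s n := fun n => (hun n).trans (hs n)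
  -- `n = log₂ N` from `N`, in unary
  have hlogsize : ∀ N : ℕ, Nat.log 2 N = Nat.size N - 1 := by
    intro N
    rcases Nat.eq_zero_or_pos N with rfl | hN
    · simp
    · have h1 : Nat.log 2 N < Nat.size N := Nat.lt_size.2 (Nat.pow_log_le_self 2 hN.ne')
      have h2 : Nat.size N ≤ Nat.log 2 N + 1 :=
        Nat.size_le.2 (Nat.lt_pow_succ_log_self one_lt_two N)
      omega
  have nC : CodeFP natE unE (fun N => Nat.log 2 N) := by
    have h1 : CodeFP natE unE (fun N => (natE N).length) := strLength.comp strOfNat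
    have h2 : CodeFP unE unE (fun m => m - 1) :=
      (strDrop.comp ((CodeFP.const unE 1).pair strOfUn)).recodeOut fun m => by
        show (unE m).drop 1 = unE (m - 1)
        rw [unE_eq_ones, unE_eq_ones]
        cases m with
        | zero => rfl
        | succ m => simp [ones, List.replicate_succ]
    exact (h2.comp h1).congr fun N => by
      show (natE N).length - 1 = Nat.log 2 N
      rw [length_natE, hlogsize]
  -- the report predicate `N = 2^{log₂ N}` as a polynomial-time map of `⟨bin N, state⟩`
  have ACC : CodeFP (pairE natE strE) bitE
      (fun r : ℕ × List Bool => decide (r.1 = 2 ^ Nat.log 2 r.1)) := by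
    have rN : CodeFP (pairE natE strE) natE (fun r : ℕ × List Bool => r.1) := CodeFP.fst _ _
    exact (natEq.comp₂ rN (natPow.comp₂ (CodeFP.const _ 2) (nC.comp rN)) :)
  obtain ⟨V, hVFP, hV⟩ := ACC
  obtain ⟨pV, MV, hMV⟩ := hVFP
  obtain ⟨MU, hMU⟩ := Trivial.exists_const_machine ([] : List Bool)
  -- the streaming algorithm: empty state, report `V`
  obtain ⟨A, hA⟩ : ∃ A : StreamingAlgorithm, A =
      { init := fun _ => []
        update := fun _ _ _ => []
        accept := fun N st => (V (boolPair (encodeNat N) st)).headD false } := ⟨_, rfl⟩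
  have hA_init : ∀ N, A.init N = [] := fun N => by rw [hA]
  have hA_upd : ∀ N st b, A.update N st b = [] := fun _ _ _ => by rw [hA]
  have hA_acc : ∀ N st, A.accept N st = (V (boolPair (encodeNat N) st)).headD false :=
    fun _ _ => by rw [hA]
  have hreach : ∀ N x, reach A N x = [] := by
    intro N x
    induction x using List.reverseRecOn with
    | nil => rw [reach_nil, hA_init]
    | append_singleton x b ih => rw [reach_append_singleton, hA_upd]
  have hacc_typed : ∀ (N : ℕ) (st : List Bool),
      V (boolPair (encodeNat N) st) = [decide (N = 2 ^ Nat.log 2 N)] := fun N st => hV (N, st)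
  -- polynomial bookkeeping
  have hpoly : ∀ q : Polynomial ℕ, ∃ e : ℕ, ∀ m, q.eval m ≤ m ^ e + e := by
    intro q
    obtain ⟨d, C, h⟩ := exists_eval_le_pow_add q
    refine ⟨d + C + 1, fun m => (h m).trans ?_⟩
    rcases Nat.eq_zero_or_pos m with rfl | hm
    · have h0 : (0 : ℕ) ^ d ≤ 1 := (Nat.pow_le_pow_left (Nat.zero_le 1) d).trans_eq (one_pow d)
      have h1 : (0 : ℕ) ^ (d + C + 1) = 0 := zero_pow (by omega)
      omega
    · exact Nat.add_le_add (Nat.pow_le_pow_right hm (by omega)) (by omega)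
  have hmono : ∀ σ e e' : ℕ, e ≤ e' → σ ^ e + e ≤ σ ^ e' + e' := by
    intro σ e e' h
    rcases Nat.eq_zero_or_pos σ with rfl | hσ
    · rcases Nat.eq_zero_or_pos e with rfl | he
      · rcases Nat.eq_zero_or_pos e' with rfl | he'
        · simp
        · have : (0 : ℕ) ^ e' = 0 := zero_pow he'.ne'
          simp only [pow_zero]
          omega
      · have h1 : (0 : ℕ) ^ e = 0 := zero_pow he.ne'
        have h2 : (0 : ℕ) ^ e' = 0 := zero_pow (by omega)
        omega
    · exact Nat.add_le_add (Nat.pow_le_pow_right hσ h) h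
  obtain ⟨e₁, he₁⟩ := hpoly (4 * X + 16)
  obtain ⟨e₂, he₂⟩ := hpoly (pV.comp (2 * X + 4))
  have he₁' : ∀ σ, 4 * σ + 16 ≤ σ ^ e₁ + e₁ := fun σ => by
    have h := he₁ σ
    simp only [eval_add, eval_mul, eval_X, eval_ofNat] at h
    exact h
  refine ⟨e₁ + e₂, A, hA_init, fun N x _ => ?_, ⟨MU, fun N x b _ => ?_⟩, ⟨MV, fun x => ?_⟩,
    fun x => ?_⟩
  · -- space: the state is empty
    rw [hreach]
    exact Nat.zero_le _
  · -- update time: the constant machine on an input of length `≤ 4 log₂ N + 14`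
    rw [hreach N x, hreach N (x ++ [b])]
    refine (hMU _).mono ?_
    have hlen := TM2Pass.length_encodeNat_le N
    have h1 := he₁' (s (Nat.log 2 N))
    have h2 := hsn (Nat.log 2 N)
    have h3 := hmono (s (Nat.log 2 N)) e₁ (e₁ + e₂) (by omega)
    simp only [length_boolPair, List.length_nil, List.length_singleton]
    omega
  · -- report time: `V ∈ FP` on an input of length `≤ 2 log₂ N + 4`
    rw [finalState_eq_reach, hreach]
    have hVz : V (boolPair (encodeNat x.length) []) = [A.accept x.length []] := by
      rw [hA_acc, hacc_typed, List.headD_cons]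
    rw [← hVz]
    refine (hMV _).mono ?_
    have hlen := TM2Pass.length_encodeNat_le x.length
    have h2 := hsn (Nat.log 2 x.length)
    have hin : (boolPair (encodeNat x.length) ([] : List Bool)).length ≤
        (2 * X + 4 : Polynomial ℕ).eval (s (Nat.log 2 x.length)) := by
      simp only [length_boolPair, List.length_nil, eval_add, eval_mul, eval_X, eval_ofNat]
      omega
    show pV.eval (boolPair (encodeNat x.length) ([] : List Bool)).length ≤ _
    calc pV.eval (boolPair (encodeNat x.length) ([] : List Bool)).length
        ≤ pV.eval ((2 * X + 4 : Polynomial ℕ).eval (s (Nat.log 2 x.length))) :=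
          TM2Iter.eval_mono pV hin
      _ ≤ s (Nat.log 2 x.length) ^ e₂ + e₂ := by rw [← eval_comp]; exact he₂ _
      _ ≤ _ := hmono _ _ _ (by omega)
  · -- the algorithm decides `MCSP[s]`
    show A.accept x.length (A.finalState x) = true ↔ x ∈ MCSPSize s
    rw [finalState_eq_reach, hreach, hA_acc, hacc_typed, List.headD_cons, decide_eq_true_eq,
      mem_MCSPSize_iff_of_univBound_le hs]

/-- **The streaming hypothesis of Theorem 1.3 is empty above the universal bound**: if
`univBound n ≤ s n` for all `n` then `¬ StreamingLowerBound s`. [folklore] -/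
theorem not_streamingLowerBound_of_univBound_le {s : ℕ → ℕ} (hs : ∀ n, univBound n ≤ s n) :
    ¬ StreamingLowerBound s := by
  intro h
  obtain ⟨c, hc⟩ := MCSPSize_mem_USTREAM_of_univBound_le hs
  exact h c hc

/-- **In particular `StreamingLowerBound (2^{kn})` fails for every `k ≥ 3`** (so the instances
`thm13_two_pow_mul k`, `k ≥ 3`, of `UniformStreamingConstructible.lean` are vacuous): the
informative range of Theorem 1.3 is `n ≤ s(n) < univBound n`. [folklore] -/
theorem not_streamingLowerBound_two_pow_mul {k : ℕ} (hk : 3 ≤ k) :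
    ¬ StreamingLowerBound (fun n => 2 ^ (k * n)) :=
  not_streamingLowerBound_of_univBound_le fun n =>
    (univBound_le_two_pow_three_mul n).trans (Nat.pow_le_pow_right Nat.two_pos
      (Nat.mul_le_mul_right n hk))

end Literature.Computability.MetaComplexity.McKayMurrayWilliams2019
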